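import Mathlib
import Summits.KontsevichZagierPeriods.Zeta5Search.BrickRegularCoefficients
import Summits.KontsevichZagierPeriods.Zeta5Search.BrickDenominatorsTwo

/-!
# BrickTwistedConstantTerm — for ODD `C` the `C`-twisted constant term of the very-well-poised brick linear form is minus
half the sum of the regular Taylor coefficients: `2·Σ_KΣ_s binom(s+C−1,C)c_{K,s}H_K^{(s+C)} = −Σ_m [T^{A+C}]F_m`
(cell `pub-zeta5`, seat ct-1 g45)

HONEST FRAMING: systematic search; no irrationality claim unless certified.  PURE ALGEBRA (finite sums over `ℚ`) about the cells
`c_{K,s}(n) = cell A B 1 n K s` of the very-well-poised brick kernel `R_n(t) = n!^{A−2B}(t + n/2)∏(t−j)^B∏(t+n+j)^B/∏(t+k)^A`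
(`A` even) and the regular Taylor coefficients `a_{m,C} = [T^{A+C}]F_m = laurent A B 1 n m (A + C)` of `R_n` at its poles.
Krattenthaler–Rivoal's constant term (Mem. AMS 875 (2007), §2.4 (eq:p0C)) at `z = 1` is
`p_{0,C,n}(1) = −(−1)^C Σ_{K≤n}Σ_{s=1}^{A} binom(s+C−1, C)·c_{K,s}·H_K^{(s+C)}`, `H_K^{(e)} = Σ_{i≤K} i^{−e}` — the constant term of
`Σ_{k≥1}(1/C!)R_n^{(C)}(k)`.  THE IDENTITY (this file): with `T(K,m) = Σ_s binom(s+C−1,C)c_{K,s}(K−m)^{−(s+C)}`,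
`a_{m,C} = (−1)^C Σ_{K≠m} T(K,m)` (`BrickRegularCoefficients.laurent_regular_eq'`), the reflection `c_{n−K,s} = (−1)^{A−s+1}c_{K,s}`
gives `T(n−K, n−m) = (−1)^{C+1}T(K,m)`, so the lower triangle `Σ_mΣ_{K<m}T` equals `(−1)^{C+1}` times the upper one, and the upper
triangle is `Σ_KΣ_s binom·c_{K,s}·H_K^{(s+C)}` (`m = K − i`).  Hence for ODD `C`: **`2·Σ_KΣ_s binom(s+C−1,C)c_{K,s}H_K^{(s+C)} =
−Σ_{m≤n} a_{m,C}`**, i.e. `2·p_{0,C,n}(1) = −Σ_m [T^{A+C}]F_m` — KR's Théorème 1 (ii) for odd `C` is the one-`d_n` saving of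
`Σ_m [T^d]F_m` at depth `d = A + C` (ct-1 g45's `BrickPropositionHDepth` at odd `p`; `BrickDenominatorsOddC`).  For EVEN `C` the
two triangles cancel (`Σ_m a_{m,C} = 0`) and nothing is learned — which is why `C = 0` needed the harmonic machinery.  Nothing here
is about `ζ(5)`; no `γ` / record statement.  Theorems only (0 `def`).  DATA (seat desk `alg/laurent.py`, exact): identity checked
on `(A,B) ∈ {(4,1),(6,1),(6,2),(8,3)}`, `n ≤ 12`, odd `C ≤ 3` (and its `ε = 0` / even-`C` twin), 0 failures.

* `cell_one_reflect` — `c_{n−K,s}(n) = (−1)^{A−s+1}c_{K,s}(n)` for the FULL kernel (`A` even, `s ≤ A`; from ct-1 g44's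
  `cell_zero_reflect` and the centre split `cell_one_eq`);
* `interaction_reflect` — `T(n−K, n−m) = T(K, m)` for odd `C`;
* `sum_sum_range_reflect`, `sum_erase_eq_lower_add_upper`, `lower_eq_upper`, `upper_eq_hsum` — the triangle bookkeeping;
* **`two_mul_twisted_eq_neg_sum_laurent`** — the identity.
-/

namespace Summit.KontsevichZagierPeriods.Zeta5Search.BrickTwistedConstantTerm

open Finset Nat
open Summit.KontsevichZagierPeriods.Zeta5Search.BrickLaurent (laurent cell)
open Summit.KontsevichZagierPeriods.Zeta5Search.BrickHarmonicBlocks (hsum)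
open Summit.KontsevichZagierPeriods.Zeta5Search.BrickCellReflectionTwo (cell_zero_reflect)
open Summit.KontsevichZagierPeriods.Zeta5Search.BrickDenominatorsTwo (cell_one_eq cell_one_top)
open Summit.KontsevichZagierPeriods.Zeta5Search.BrickRegularCoefficients (laurent_regular_eq')

noncomputable section

/-! ## Reflection for the full kernel -/

/-- **`c_{n−K,s}(n) = (−1)^{A−s+1}·c_{K,s}(n)`** for the very-well-poised kernel `ε = 1` (`A` even, `K ≤ n`, `s ≤ A`): the
centre-free cells reflect with `(−1)^{A−s}` (ct-1 g44) and the centre factor `n/2 − K` is reflection-odd. -/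
theorem cell_one_reflect {A : ℕ} (hA : Even A) (B : ℕ) {n K : ℕ} (hK : K ≤ n) {s : ℕ} (hs : s ≤ A) :
    cell A B 1 n (n - K) s = (-1) ^ (A - s + 1) * cell A B 1 n K s := by
  have hcast : ((n : ℚ) / 2 - ((n - K : ℕ) : ℚ)) = -((n : ℚ) / 2 - K) := by push_cast [Nat.cast_sub hK]; ring
  rcases Nat.lt_or_ge s A with hsA | hsA
  · have h1 : ((-1 : ℚ)) ^ (A - (s + 1)) = (-1) ^ (A - s + 1) := by
      rw [show A - s + 1 = A - (s + 1) + 2 by omega, pow_add, neg_one_sq, mul_one]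
    have h2 : -((-1 : ℚ)) ^ (A - s) = (-1) ^ (A - s + 1) := by rw [pow_succ, mul_neg_one]
    rw [cell_one_eq n (n - K) (by omega : s + 1 ≤ A), cell_one_eq n K (by omega : s + 1 ≤ A),
      cell_zero_reflect hA B hK, cell_zero_reflect hA B hK, hcast, h1, mul_add]
    rw [show -((n : ℚ) / 2 - K) * ((-1) ^ (A - s) * cell A B 0 n K s) =
      -(-1 : ℚ) ^ (A - s) * (((n : ℚ) / 2 - K) * cell A B 0 n K s) by ring, h2]
  · have hsA' : s = A := le_antisymm hs hsA
    subst hsA'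
    rw [cell_one_top n (n - K), cell_one_top n K, cell_zero_reflect hA B hK, hcast, Nat.sub_self, pow_zero, one_mul,
      zero_add, pow_one]
    ring

/-! ## The interaction of two poles and its reflection -/

/-- **`T(n−K, n−m) = T(K, m)`** for odd `C` (`A` even; `K, m ≤ n`), where
`T(K,m) = Σ_{s∈[1,A]} binom(s+C−1,C)·c_{K,s}/(K−m)^{s+C}`: the cell sign `(−1)^{A−s+1}` and the distance sign `(−1)^{s+C}` agree. -/
theorem interaction_reflect {A : ℕ} (hA : Even A) (B : ℕ) {C : ℕ} (hC : Odd C) {n K m : ℕ} (hK : K ≤ n) (hm : m ≤ n) :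
    ∑ s ∈ Icc 1 A, (Nat.choose (s + C - 1) C : ℚ) * cell A B 1 n (n - K) s / (((n - K : ℕ) : ℚ) - ((n - m : ℕ) : ℚ)) ^ (s + C) =
      ∑ s ∈ Icc 1 A, (Nat.choose (s + C - 1) C : ℚ) * cell A B 1 n K s / ((K : ℚ) - m) ^ (s + C) := by
  refine Finset.sum_congr rfl fun s hs => ?_
  have hs' := mem_Icc.1 hs
  have hsign : ((-1 : ℚ)) ^ (A - s + 1) = (-1) ^ (s + C) := by
    have hprod : ((-1 : ℚ)) ^ (A - s + 1) * (-1) ^ (s + C) = 1 := by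
      rw [← pow_add, show A - s + 1 + (s + C) = A + (C + 1) by omega]
      exact (hA.add (hC.add_odd odd_one)).neg_one_pow
    have hu : ((-1 : ℚ)) ^ (s + C) * (-1) ^ (s + C) = 1 := by rw [← pow_add, ← two_mul, pow_mul, neg_one_sq, one_pow]
    calc ((-1 : ℚ)) ^ (A - s + 1) = (-1) ^ (A - s + 1) * ((-1) ^ (s + C) * (-1) ^ (s + C)) := by rw [hu, mul_one]
      _ = (-1) ^ (s + C) := by rw [← mul_assoc, hprod, one_mul]
  have hσ : ((-1 : ℚ)) ^ (s + C) ≠ 0 := pow_ne_zero _ (by norm_num)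
  rw [cell_one_reflect hA B hK hs'.2, hsign, show (((n - K : ℕ) : ℚ) - ((n - m : ℕ) : ℚ)) = -((K : ℚ) - m) by
    push_cast [Nat.cast_sub hK, Nat.cast_sub hm]; ring, neg_pow ((K : ℚ) - m), mul_left_comm, mul_div_mul_left _ _ hσ]

/-! ## Triangle bookkeeping on the square `[0,n]²` -/

/-- Reflecting both indices of a double sum over `[0,n]²`. -/
theorem sum_sum_range_reflect (f : ℕ → ℕ → ℚ) (n : ℕ) :
    ∑ m ∈ range (n + 1), ∑ K ∈ range (n + 1), f m K = ∑ m ∈ range (n + 1), ∑ K ∈ range (n + 1), f (n - m) (n - K) := by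
  symm
  rw [show (∑ m ∈ range (n + 1), ∑ K ∈ range (n + 1), f (n - m) (n - K)) =
      ∑ m ∈ range (n + 1), (fun j => ∑ K ∈ range (n + 1), f j (n - K)) (n + 1 - 1 - m) by simp only [Nat.add_sub_cancel],
    sum_range_reflect (fun j => ∑ K ∈ range (n + 1), f j (n - K)) (n + 1)]
  refine Finset.sum_congr rfl fun j _ => ?_
  show (∑ K ∈ range (n + 1), f j (n - K)) = ∑ K ∈ range (n + 1), f j K
  rw [show (∑ K ∈ range (n + 1), f j (n - K)) = ∑ K ∈ range (n + 1), (fun K => f j K) (n + 1 - 1 - K) by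
    simp only [Nat.add_sub_cancel], sum_range_reflect (fun K => f j K) (n + 1)]

/-- `Σ_{K ≠ m} g(K) = Σ_K [K < m]·g(K) + Σ_K [m < K]·g(K)` on `[0,n]`. -/
theorem sum_erase_eq_lower_add_upper (g : ℕ → ℚ) (n m : ℕ) :
    ∑ K ∈ (range (n + 1)).erase m, g K =
      ∑ K ∈ range (n + 1), (if K < m then g K else 0) + ∑ K ∈ range (n + 1), (if m < K then g K else 0) := by
  rw [← Finset.sum_add_distrib, ← Finset.sum_erase (range (n + 1))
    (f := fun K => (if K < m then g K else 0) + if m < K then g K else 0) (a := m)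
    (by simp only [lt_self_iff_false, if_false, add_zero])]
  refine Finset.sum_congr rfl fun K hK => ?_
  rcases lt_or_gt_of_ne (ne_of_mem_erase hK) with h | h
  · rw [if_pos h, if_neg (by omega), add_zero]
  · rw [if_neg (by omega), if_pos h, zero_add]

/-- `Σ_{m<K} (K−m)^{−e} = H_K^{(e)}` (`i = K − m`). -/
theorem sum_range_inv_pow_eq_hsum (K e : ℕ) : ∑ m ∈ range K, 1 / ((K : ℚ) - m) ^ e = hsum e K := by
  rw [hsum]
  refine Finset.sum_nbij' (fun m => K - m) (fun i => K - i) (fun m hm => ?_) (fun i hi => ?_) (fun m hm => ?_)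
    (fun i hi => ?_) (fun m hm => ?_)
  · have := mem_range.1 hm; exact mem_Icc.2 ⟨by omega, by omega⟩
  · have := mem_Icc.1 hi; exact mem_range.2 (by omega)
  · have := mem_range.1 hm; omega
  · have := mem_Icc.1 hi; omega
  · have := mem_range.1 hm; rw [Nat.cast_sub (by omega)]

section identity

variable {A B : ℕ} (hA : Even A) (hAB : 2 * B ≤ A) (hA1 : 1 < A) {C : ℕ} (hC : Odd C) (n : ℕ)
include hA hC

/-- **Lower triangle = upper triangle** (odd `C`): `Σ_mΣ_K [K<m]·T(K,m) = Σ_mΣ_K [m<K]·T(K,m)` on `[0,n]²`, by the reflection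
`(m,K) ↦ (n−m, n−K)` and `interaction_reflect`. -/
theorem lower_eq_upper :
    ∑ m ∈ range (n + 1), ∑ K ∈ range (n + 1), (if K < m then
        ∑ s ∈ Icc 1 A, (Nat.choose (s + C - 1) C : ℚ) * cell A B 1 n K s / ((K : ℚ) - m) ^ (s + C) else 0) =
      ∑ m ∈ range (n + 1), ∑ K ∈ range (n + 1), (if m < K then
        ∑ s ∈ Icc 1 A, (Nat.choose (s + C - 1) C : ℚ) * cell A B 1 n K s / ((K : ℚ) - m) ^ (s + C) else 0) := by
  refine Eq.trans ?_ (sum_sum_range_reflect (fun m K => if m < K then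
    ∑ s ∈ Icc 1 A, (Nat.choose (s + C - 1) C : ℚ) * cell A B 1 n K s / ((K : ℚ) - m) ^ (s + C) else 0) n).symm
  refine Finset.sum_congr rfl fun m hm => Finset.sum_congr rfl fun K hK => ?_
  have hm' : m ≤ n := by have := mem_range.1 hm; omega
  have hK' : K ≤ n := by have := mem_range.1 hK; omega
  by_cases h : K < m
  · rw [if_pos h, if_pos (by omega), interaction_reflect hA B hC hK' hm']
  · rw [if_neg h, if_neg (by omega)]

omit hA hC in
/-- **The upper triangle is the twisted harmonic sum**: `Σ_mΣ_K [m<K]·T(K,m) = Σ_KΣ_s binom(s+C−1,C)·c_{K,s}·H_K^{(s+C)}`. -/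
theorem upper_eq_hsum :
    ∑ m ∈ range (n + 1), ∑ K ∈ range (n + 1), (if m < K then
        ∑ s ∈ Icc 1 A, (Nat.choose (s + C - 1) C : ℚ) * cell A B 1 n K s / ((K : ℚ) - m) ^ (s + C) else 0) =
      ∑ K ∈ range (n + 1), ∑ s ∈ Icc 1 A, (Nat.choose (s + C - 1) C : ℚ) * cell A B 1 n K s * hsum (s + C) K := by
  rw [Finset.sum_comm]
  refine Finset.sum_congr rfl fun K hK => ?_
  have hK' : K ≤ n := by have := mem_range.1 hK; omega
  have hfilter : (range (n + 1)).filter (fun m => m < K) = range K := by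
    ext m; simp only [mem_filter, mem_range]; omega
  rw [← Finset.sum_filter, hfilter, Finset.sum_comm]
  refine Finset.sum_congr rfl fun s _ => ?_
  rw [← sum_range_inv_pow_eq_hsum, Finset.mul_sum]
  exact Finset.sum_congr rfl fun m _ => by rw [mul_one_div]

include hAB hA1

/-- **THE IDENTITY** (`A` even, `2B ≤ A`, `1 < A`, `C` ODD, every `n`):
`2·Σ_{K≤n}Σ_{s∈[1,A]} binom(s+C−1, C)·c_{K,s}(n)·H_K^{(s+C)} = −Σ_{m≤n} [T^{A+C}]F_m`
— the `C`-twisted constant term of the very-well-poised brick linear form (Krattenthaler–Rivoal's `(−1)^{C+1}p_{0,C,n}(1)`) is minus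
half the sum of the regular Taylor coefficients of `R_n` of order `C` at its poles. -/
theorem two_mul_twisted_eq_neg_sum_laurent :
    2 * ∑ K ∈ range (n + 1), ∑ s ∈ Icc 1 A, (Nat.choose (s + C - 1) C : ℚ) * cell A B 1 n K s * hsum (s + C) K =
      -∑ m ∈ range (n + 1), laurent A B 1 n m (A + C) := by
  have ha : ∀ m ∈ range (n + 1), laurent A B 1 n m (A + C) = -∑ K ∈ (range (n + 1)).erase m,
      ∑ s ∈ Icc 1 A, (Nat.choose (s + C - 1) C : ℚ) * cell A B 1 n K s / ((K : ℚ) - m) ^ (s + C) := fun m hm => by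
    rw [laurent_regular_eq' hAB hA1 (by have := mem_range.1 hm; omega) C, hC.neg_one_pow, neg_one_mul]
  rw [Finset.sum_congr rfl ha, Finset.sum_neg_distrib, neg_neg,
    Finset.sum_congr rfl fun (m : ℕ) _ => sum_erase_eq_lower_add_upper
      (fun K => ∑ s ∈ Icc 1 A, (Nat.choose (s + C - 1) C : ℚ) * cell A B 1 n K s / ((K : ℚ) - (m : ℚ)) ^ (s + C)) n m,
    Finset.sum_add_distrib, lower_eq_upper hA hC n, ← two_mul, upper_eq_hsum]

end identity

end

end Summit.KontsevichZagierPeriods.Zeta5Search.BrickTwistedConstantTerm
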